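import Summits.QuantumFields.YangMills.Theorems.VirialFluxGapRingFrameTaylor
import Summits.QuantumFields.YangMills.Theorems.VirialFluxGapResolventFieldEstimates
import HarnessLib

/-!
# Route `VirialFluxGap` (YangMills): the RESOLVENT EULER FIELD — the POINTWISE TAYLOR PACKAGE in a frame basis

Toward the deciding crux `VirialFluxGap.PeriodicSoftness` (item stmt-QuantumFields-24141), generic-region Euler field `X_g = ½(H+λ⋆)⁻¹g`
(memo `fcl-p3-g40-RESOLVENT-EULER-FIELD-24141.md`).  Given a finite family of direction assignments `τ_j` (`j : ι`; e.g. one 𝔰𝔲(2) basis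
vector at one variable of Ω_L or of the tree-gauged X_fix — the file is agnostic) this file turns the letters of ✓`VirialFluxGapRingFrameTaylor`
into EXACTLY the hypotheses of ✓`ResolventField.drive_lower_of_taylor` ∕ ✓`ResolventField.divergence_upper` at a point `P` whose
multi-direction translate `p = P·exp(Y_u)`, `Y_u = Σ_j u_j τ_j`, is a zero of `F₀`:

* §1 `dirOf τ u = Σ_j u_j τ_j` (skew-Hermitian, traceless), the frame GRADIENT `g_j = ∂_{τ_j}F₀`, the raw second derivatives
  `Ĥ_jk = ∂_{τ_j}∂_{τ_k}F₀` and the symmetrised frame HESSIAN `H = ½(Ĥ + Ĥᵀ)` as functions of the ambient coordinates; bilinearity: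
  `∂_{Y_u}F₀ = gᵀu`, `∂_{Y_u}∂_{τ_k}F₀ = (Ĥᵀu)_k`, `∂_{Y_u}∂_{Y_u}F₀ = uᵀĤu = uᵀHu`;
* §2 ★★★ `pointwise_taylor_package` — with `r := g + Hu` and sup bounds `K₁, K₂, K₃` on the third frame derivatives
  `∂_{Y_u}∂_{τ_j}∂_{τ_k}F₀`, `∂_{Y_u}∂_{Y_u}∂_{τ_k}F₀`, `∂_{Y_u}³F₀` over the ring space:
  (c1) `|F₀(P) − (½uᵀHu − rᵀu)| ≤ K₃` (the relation `F = ½uᵀHu − rᵀu + ρ₃`, `|ρ₃| ≤ K₃`);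
  (c2) `|r_k| ≤ K₂ + K₁·Σ_j|u_j|` for every `k`;
  (c3) at the zero: `Ĥ(p)` is SYMMETRIC and POSITIVE-SEMIDEFINITE (`vᵀĤ(p)v = ∂_{Y_v}²F₀(p) ≥ 0`);
  (c4) Hessian drift `|H_jk(P) − H_jk(p)| ≤ K₁`;
* §3 ★ `floor_of_drift` — consequently `vᵀ(H(P) + λ⋆)v ≥ (λ⋆ − #ι·K₁)|v|²` (the positive floor of the matrix layer once `#ι·K₁ ≤ λ⋆/2`), and
  ★ `approxKernel_of_kernel` — a unit vector `k` with `Ĥ(p)k = 0` has `kᵀH(P)k ≤ #ι·K₁` (the `s` of ✓`trace_resolvent_le`).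

HONEST FRAMING: bookkeeping between landed layers; the polynomial VALUES of `K₁, K₂, K₃` (ambient derivative bounds of the quartic `ringPoly`),
the quadratic-growth input `κ|u|² ≤ F₀(P)` (w2's regular-valley Łojasiewicz), the kernel family at `p`, the cut-offs and the central charts are
NOT here; ⟨24141⟩ stays OPEN; no stub / crux / rung / summit is closed; the Yang–Mills mass gap is NOT proved; no summit is proved by a line.
Definitions (`dirOf`, `frameGrad`, `frameHessRaw`, `frameHess`) are problem-side plumbing (no `Prop`); 0 `sorry`, standard axioms.
Explicit-unit seat `ym-line-fcl-p3` g40 (cell ym-idea-1, free hands), `--supports stmt-QuantumFields-24141`.  References: [folklore].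
-/

set_option autoImplicit false

noncomputable section

open scoped Matrix BigOperators ContDiff Topology
open MeasureTheory Set Matrix
open Literature.MathematicalPhysics.QuantumFieldTheory hiding SU2
open Literature.MathematicalPhysics.QuantumLattice
open Literature.MathematicalPhysics.QuantumFieldTheory.SUNBakryEmery (expSU coe_expSU matTop)

namespace Summit.QuantumFields.YangMills.Theorems.VirialFluxGap.FrameHessian

open Summit.QuantumFields.YangMills.Theorems.FemtoTransferGap
open Summit.QuantumFields.YangMills.Theorems.FemtoTransferGap.TT
open Summit.QuantumFields.YangMills.Theorems.VirialFluxGap.RingDeficit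
open Summit.QuantumFields.YangMills.Theorems.VirialFluxGap.FrameDerivative

variable {L : ℕ} [NeZero L]
variable {ι : Type*}

open scoped Matrix.Norms.Frobenius

attribute [local instance 2000] Literature.MathematicalPhysics.QuantumFieldTheory.SUNBakryEmery.matTop

/-! ## §1 Frame basis bookkeeping -/

omit [NeZero L] in
/-- The direction assignment with coordinates `u` in the frame family `τ`: `Y_u = Σ_j u_j τ_j`. [folklore] -/
def dirOf [Fintype ι] (τ : ι → ((Fin (2 * L - 1 + 1) × Edge 3 L) ⊕ Site 3 L) → Matrix (Fin 2) (Fin 2) ℂ) (u : ι → ℝ) : ((Fin (2 * L - 1 + 1) × Edge 3 L) ⊕ Site 3 L) → Matrix (Fin 2) (Fin 2) ℂ := ∑ j, u j • τ j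

/-- The frame GRADIENT of the zero-flux deficit in the family `τ`, as a function of the ambient coordinates: `g_j(M) = ∂_{τ_j} ringPoly (M)`.
[folklore] -/
def frameGrad (τ : ι → ((Fin (2 * L - 1 + 1) × Edge 3 L) ⊕ Site 3 L) → Matrix (Fin 2) (Fin 2) ℂ) (M : ((Fin (2 * L - 1 + 1) → Edge 3 L → Matrix (Fin 2) (Fin 2) ℂ) × (Site 3 L → Matrix (Fin 2) (Fin 2) ℂ))) : ι → ℝ := fun j => frameD (τ j) (ringPoly L) M

/-- The RAW second frame derivatives `Ĥ_jk(M) = ∂_{τ_j}∂_{τ_k} ringPoly (M)` (not symmetric off the zero set). [folklore] -/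
def frameHessRaw (τ : ι → ((Fin (2 * L - 1 + 1) × Edge 3 L) ⊕ Site 3 L) → Matrix (Fin 2) (Fin 2) ℂ) (M : ((Fin (2 * L - 1 + 1) → Edge 3 L → Matrix (Fin 2) (Fin 2) ℂ) × (Site 3 L → Matrix (Fin 2) (Fin 2) ℂ))) : Matrix ι ι ℝ :=
  fun j k => frameD (τ j) (frameD (τ k) (ringPoly L)) M

/-- The symmetrised frame HESSIAN `H = ½(Ĥ + Ĥᵀ)`. [folklore] -/
def frameHess (τ : ι → ((Fin (2 * L - 1 + 1) × Edge 3 L) ⊕ Site 3 L) → Matrix (Fin 2) (Fin 2) ℂ) (M : ((Fin (2 * L - 1 + 1) → Edge 3 L → Matrix (Fin 2) (Fin 2) ℂ) × (Site 3 L → Matrix (Fin 2) (Fin 2) ℂ))) : Matrix ι ι ℝ :=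
  fun j k => (1 / 2) * (frameHessRaw (L := L) τ M j k + frameHessRaw (L := L) τ M k j)

omit [NeZero L] in
/-- `Y_u` is skew-Hermitian when the `τ_j` are. [folklore] -/
theorem dirOf_conjTranspose [Fintype ι] {τ : ι → ((Fin (2 * L - 1 + 1) × Edge 3 L) ⊕ Site 3 L) → Matrix (Fin 2) (Fin 2) ℂ} (hτ : ∀ j w, (τ j w)ᴴ = -τ j w) (u : ι → ℝ) (w : ((Fin (2 * L - 1 + 1) × Edge 3 L) ⊕ Site 3 L)) :
    (dirOf τ u w)ᴴ = -dirOf τ u w := by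
  simp only [dirOf, Finset.sum_apply, Pi.smul_apply, Matrix.conjTranspose_sum, Matrix.conjTranspose_smul, star_trivial, hτ,
    smul_neg, Finset.sum_neg_distrib]

omit [NeZero L] in
/-- `Y_u` is traceless when the `τ_j` are. [folklore] -/
theorem dirOf_trace [Fintype ι] {τ : ι → ((Fin (2 * L - 1 + 1) × Edge 3 L) ⊕ Site 3 L) → Matrix (Fin 2) (Fin 2) ℂ} (hτ0 : ∀ j w, (τ j w).trace = 0) (u : ι → ℝ) (w : ((Fin (2 * L - 1 + 1) × Edge 3 L) ⊕ Site 3 L)) :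
    (dirOf τ u w).trace = 0 := by
  simp only [dirOf, Finset.sum_apply, Pi.smul_apply, Matrix.trace_sum, Matrix.trace_smul, hτ0, smul_zero, Finset.sum_const_zero]

/-- The frame Hessian is symmetric. [folklore] -/
theorem frameHess_transpose (τ : ι → ((Fin (2 * L - 1 + 1) × Edge 3 L) ⊕ Site 3 L) → Matrix (Fin 2) (Fin 2) ℂ) (M : ((Fin (2 * L - 1 + 1) → Edge 3 L → Matrix (Fin 2) (Fin 2) ℂ) × (Site 3 L → Matrix (Fin 2) (Fin 2) ℂ))) : (frameHess (L := L) τ M)ᵀ = frameHess (L := L) τ M := by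
  ext j k
  simp only [Matrix.transpose_apply, frameHess]
  ring

omit [NeZero L] in
/-- ★ First-order bilinearity: `∂_{Y_u} f = Σ_j u_j ∂_{τ_j} f`. [folklore] -/
theorem frameD_dirOf [Fintype ι] (τ : ι → ((Fin (2 * L - 1 + 1) × Edge 3 L) ⊕ Site 3 L) → Matrix (Fin 2) (Fin 2) ℂ) (u : ι → ℝ) (f : ((Fin (2 * L - 1 + 1) → Edge 3 L → Matrix (Fin 2) (Fin 2) ℂ) × (Site 3 L → Matrix (Fin 2) (Fin 2) ℂ)) → ℝ) (M : ((Fin (2 * L - 1 + 1) → Edge 3 L → Matrix (Fin 2) (Fin 2) ℂ) × (Site 3 L → Matrix (Fin 2) (Fin 2) ℂ))) :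
    frameD (dirOf τ u) f M = ∑ j, u j * frameD (τ j) f M := by
  rw [dirOf]
  exact frameD_sum_smul_dir Finset.univ u τ f M

/-- Linearity of the frame derivative in the FUNCTION: `∂_Y (Σ_k c_k h_k) = Σ_k c_k ∂_Y h_k` for smooth `h_k`. [folklore] -/
theorem frameD_fun_sum [Fintype ι] (Y : ((Fin (2 * L - 1 + 1) × Edge 3 L) ⊕ Site 3 L) → Matrix (Fin 2) (Fin 2) ℂ) (c : ι → ℝ) {h : ι → ((Fin (2 * L - 1 + 1) → Edge 3 L → Matrix (Fin 2) (Fin 2) ℂ) × (Site 3 L → Matrix (Fin 2) (Fin 2) ℂ)) → ℝ} (hh : ∀ k, ContDiff ℝ ∞ (h k)) (M : ((Fin (2 * L - 1 + 1) → Edge 3 L → Matrix (Fin 2) (Fin 2) ℂ) × (Site 3 L → Matrix (Fin 2) (Fin 2) ℂ))) :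
    frameD Y (fun M' => ∑ k, c k * h k M') M = ∑ k, c k * frameD Y (h k) M := by
  have hd : ∀ k, HasFDerivAt (fun M' => c k * h k M') (c k • fderiv ℝ (h k) M) M := fun k =>
    (((hh k).differentiable (by simp) M).hasFDerivAt).const_mul (c k)
  have hs : HasFDerivAt (fun M' => ∑ k, c k * h k M') (∑ k, c k • fderiv ℝ (h k) M) M :=
    HasFDerivAt.fun_sum fun k _ => hd k
  rw [frameD, hs.fderiv, FunLike.coe_sum, Finset.sum_apply]
  refine Finset.sum_congr rfl fun k _ => ?_
  rw [FunLike.coe_smul, Pi.smul_apply, smul_eq_mul, frameD]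

/-- ★ `∂_{Y_u}∂_{τ_k} F₀ (M) = Σ_j u_j Ĥ_jk(M) = (Ĥᵀ u)_k`. [folklore] -/
theorem frameD_dirOf_frameD [Fintype ι] (τ : ι → ((Fin (2 * L - 1 + 1) × Edge 3 L) ⊕ Site 3 L) → Matrix (Fin 2) (Fin 2) ℂ) (u : ι → ℝ) (k : ι) (M : ((Fin (2 * L - 1 + 1) → Edge 3 L → Matrix (Fin 2) (Fin 2) ℂ) × (Site 3 L → Matrix (Fin 2) (Fin 2) ℂ))) :
    frameD (dirOf τ u) (frameD (τ k) (ringPoly L)) M = ∑ j, u j * frameHessRaw (L := L) τ M j k := by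
  rw [frameD_dirOf]
  rfl

/-- ★ Second-order bilinearity: `∂_{Y_u}∂_{Y_u} F₀ (M) = Σ_j Σ_k u_j u_k Ĥ_jk(M) = uᵀĤu`. [folklore] -/
theorem frameD_dirOf_frameD_dirOf [Fintype ι] (τ : ι → ((Fin (2 * L - 1 + 1) × Edge 3 L) ⊕ Site 3 L) → Matrix (Fin 2) (Fin 2) ℂ) (u : ι → ℝ) (M : ((Fin (2 * L - 1 + 1) → Edge 3 L → Matrix (Fin 2) (Fin 2) ℂ) × (Site 3 L → Matrix (Fin 2) (Fin 2) ℂ))) :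
    frameD (dirOf τ u) (frameD (dirOf τ u) (ringPoly L)) M = u ⬝ᵥ (frameHessRaw (L := L) τ M *ᵥ u) := by
  have heq : frameD (dirOf τ u) (ringPoly L) = fun M' => ∑ k, u k * frameD (τ k) (ringPoly L) M' :=
    funext fun M' => frameD_dirOf τ u (ringPoly L) M'
  rw [heq, frameD_dirOf, dotProduct]
  refine Finset.sum_congr rfl fun j _ => ?_
  rw [frameD_fun_sum (τ j) u (fun k => contDiff_frameD (contDiff_ringPoly (L := L)) (τ k)) M, mulVec, dotProduct]
  congr 1
  refine Finset.sum_congr rfl fun k _ => ?_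
  rw [frameHessRaw, mul_comm]

/-- The raw and the symmetrised Hessian have the same quadratic form. [folklore] -/
theorem dotProduct_frameHess [Fintype ι] (τ : ι → ((Fin (2 * L - 1 + 1) × Edge 3 L) ⊕ Site 3 L) → Matrix (Fin 2) (Fin 2) ℂ) (M : ((Fin (2 * L - 1 + 1) → Edge 3 L → Matrix (Fin 2) (Fin 2) ℂ) × (Site 3 L → Matrix (Fin 2) (Fin 2) ℂ))) (u : ι → ℝ) :
    u ⬝ᵥ (frameHess (L := L) τ M *ᵥ u) = u ⬝ᵥ (frameHessRaw (L := L) τ M *ᵥ u) := by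
  simp only [dotProduct, mulVec, frameHess, Finset.mul_sum]
  have h : ∑ j, ∑ k, u j * ((1 / 2) * (frameHessRaw (L := L) τ M j k + frameHessRaw (L := L) τ M k j) * u k) =
      (1 / 2) * ∑ j, ∑ k, u j * (frameHessRaw (L := L) τ M j k * u k) + (1 / 2) * ∑ j, ∑ k, u j * (frameHessRaw (L := L) τ M k j * u k) := by
    rw [Finset.mul_sum, Finset.mul_sum, ← Finset.sum_add_distrib]
    refine Finset.sum_congr rfl fun j _ => ?_
    rw [Finset.mul_sum, Finset.mul_sum, ← Finset.sum_add_distrib]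
    refine Finset.sum_congr rfl fun k _ => ?_
    ring
  have hswap : ∑ j, ∑ k, u j * (frameHessRaw (L := L) τ M k j * u k) = ∑ j, ∑ k, u j * (frameHessRaw (L := L) τ M j k * u k) := by
    rw [Finset.sum_comm]
    refine Finset.sum_congr rfl fun j _ => Finset.sum_congr rfl fun k _ => ?_
    ring
  rw [h, hswap]
  ring

/-! ## §2 The pointwise Taylor package at a point with a nearby zero -/

/-- ★★★ **THE POINTWISE TAYLOR PACKAGE.**  Let `τ_j` be skew-Hermitian traceless assignments, `u : ι → ℝ`, and suppose the translate
`p = P·exp(Y_u)` of `P` along `Y_u = Σ_j u_j τ_j` is a ZERO of `F₀`.  With `g = frameGrad τ (ringCoord P)`, `H = frameHess τ (ringCoord P)`,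
`r = g + Hu`, and sup bounds `K₁ ≥ |∂_{Y_u}∂_{τ_j}∂_{τ_k}F₀|`, `K₂ ≥ |∂_{Y_u}∂_{Y_u}∂_{τ_k}F₀|`, `K₃ ≥ |∂_{Y_u}³F₀|` on the ring space:
(c1) `|F₀(P) − (½uᵀHu − rᵀu)| ≤ K₃`; (c2) `|r_k| ≤ K₂ + K₁Σ_j|u_j|`; (c3) `Ĥ(p)` symmetric with `vᵀĤ(p)v ≥ 0`; (c4) `|H_jk(P) − H_jk(p)| ≤ K₁`.
[folklore] -/
theorem pointwise_taylor_package [Fintype ι] {τ : ι → ((Fin (2 * L - 1 + 1) × Edge 3 L) ⊕ Site 3 L) → Matrix (Fin 2) (Fin 2) ℂ} (hτ : ∀ j w, (τ j w)ᴴ = -τ j w)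
    (hτ0 : ∀ j w, (τ j w).trace = 0) (u : ι → ℝ) (P : ((Fin (2 * L - 1 + 1) → GaugeConfig 3 L SU2) × (Site 3 L → SU2)))
    (hp : ringDeficit L (fun _ => false) (P * multiCurve (dirOf τ u) (dirOf_conjTranspose hτ u) (dirOf_trace hτ0 u) 1) = 0)
    {K₁ K₂ K₃ : ℝ}
    (hK1 : ∀ j k (Q : ((Fin (2 * L - 1 + 1) → GaugeConfig 3 L SU2) × (Site 3 L → SU2))), |frameD (dirOf τ u) (frameD (τ j) (frameD (τ k) (ringPoly L))) (ringCoord L Q)| ≤ K₁)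
    (hK2 : ∀ k (Q : ((Fin (2 * L - 1 + 1) → GaugeConfig 3 L SU2) × (Site 3 L → SU2))), |frameD (dirOf τ u) (frameD (dirOf τ u) (frameD (τ k) (ringPoly L))) (ringCoord L Q)| ≤ K₂)
    (hK3 : ∀ Q : ((Fin (2 * L - 1 + 1) → GaugeConfig 3 L SU2) × (Site 3 L → SU2)), |frameD (dirOf τ u) (frameD (dirOf τ u) (frameD (dirOf τ u) (ringPoly L))) (ringCoord L Q)| ≤ K₃) :
    (|ringDeficit L (fun _ => false) P -
        ((1 / 2) * (u ⬝ᵥ (frameHess (L := L) τ (ringCoord L P) *ᵥ u)) -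
          (frameGrad (L := L) τ (ringCoord L P) + frameHess (L := L) τ (ringCoord L P) *ᵥ u) ⬝ᵥ u)| ≤ K₃) ∧
    (∀ k, |(frameGrad (L := L) τ (ringCoord L P) + frameHess (L := L) τ (ringCoord L P) *ᵥ u) k| ≤ K₂ + K₁ * ∑ j, |u j|) ∧
    ((frameHessRaw (L := L) τ (ringCoord L (P * multiCurve (dirOf τ u) (dirOf_conjTranspose hτ u) (dirOf_trace hτ0 u) 1)))ᵀ =
        frameHessRaw (L := L) τ (ringCoord L (P * multiCurve (dirOf τ u) (dirOf_conjTranspose hτ u) (dirOf_trace hτ0 u) 1)) ∧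
      ∀ v : ι → ℝ, 0 ≤ v ⬝ᵥ (frameHessRaw (L := L) τ
        (ringCoord L (P * multiCurve (dirOf τ u) (dirOf_conjTranspose hτ u) (dirOf_trace hτ0 u) 1)) *ᵥ v)) ∧
    (∀ j k, |frameHess (L := L) τ (ringCoord L P) j k -
        frameHess (L := L) τ (ringCoord L (P * multiCurve (dirOf τ u) (dirOf_conjTranspose hτ u) (dirOf_trace hτ0 u) 1)) j k| ≤ K₁) := by
  set Yu := dirOf τ u with hYu
  have hYuH : ∀ w, (Yu w)ᴴ = -Yu w := dirOf_conjTranspose hτ u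
  have hYu0 : ∀ w, (Yu w).trace = 0 := dirOf_trace hτ0 u
  set p := P * multiCurve Yu hYuH hYu0 1 with hpdef
  set M := ringCoord L P with hM
  set g := frameGrad (L := L) τ M with hg
  set Hr := frameHessRaw (L := L) τ M with hHr
  set H := frameHess (L := L) τ M with hH
  have hHsymm : Hᵀ = H := frameHess_transpose τ M
  -- first-order data: `∂_{Y_u}F₀(M) = g ⬝ u`, second-order: `∂_{Y_u}²F₀(M) = u ⬝ H u`
  have h1 : frameD Yu (ringPoly L) M = g ⬝ᵥ u := by
    rw [hYu, frameD_dirOf, dotProduct]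
    refine Finset.sum_congr rfl fun j _ => ?_
    rw [hg, frameGrad, mul_comm]
  have h2 : frameD Yu (frameD Yu (ringPoly L)) M = u ⬝ᵥ (H *ᵥ u) := by
    rw [hYu, frameD_dirOf_frameD_dirOf, ← dotProduct_frameHess]
  refine ⟨?_, ?_, ⟨?_, ?_⟩, ?_⟩
  · -- (c1) from the deficit letter: `|F + g⬝u + ½ u⬝Hu| ≤ K₃`, and `g⬝u = r⬝u − u⬝Hu`
    have hT := deficit_taylor_at_zero Yu hYuH hYu0 P hp hK3
    rw [h1, h2] at hT
    have hgu : g ⬝ᵥ u = (g + H *ᵥ u) ⬝ᵥ u - u ⬝ᵥ (H *ᵥ u) := by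
      rw [add_dotProduct, ResolventField.dotProduct_mulVec_symm hHsymm u u]; ring
    rw [hgu] at hT
    convert hT using 2
    ring
  · -- (c2) `r_k = [g_k + Σ_j u_j Ĥ_jk] + ½ Σ_j u_j (Ĥ_kj − Ĥ_jk)`
    intro k
    have hT := gradient_taylor_at_zero Yu (τ k) hYuH hYu0 (hτ k) (hτ0 k) P hp (hK2 k)
    rw [hYu, frameD_dirOf_frameD] at hT
    have hanti : ∀ j, |frameHessRaw (L := L) τ M k j - frameHessRaw (L := L) τ M j k| ≤ 2 * K₁ := fun j =>
      antisymm_small_near_zero Yu (τ k) (τ j) hYuH hYu0 (hτ k) (hτ j) P hp (hK1 k j) (hK1 j k)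
    have hr : (g + H *ᵥ u) k = (frameGrad (L := L) τ M k + ∑ j, u j * frameHessRaw (L := L) τ M j k) +
        ∑ j, (1 / 2) * u j * (frameHessRaw (L := L) τ M k j - frameHessRaw (L := L) τ M j k) := by
      rw [Pi.add_apply, hg, hH, mulVec, dotProduct, add_assoc, ← Finset.sum_add_distrib]
      congr 1
      refine Finset.sum_congr rfl fun j _ => ?_
      simp only [frameHess]
      ring
    rw [hr]
    have hsum : |∑ j, (1 / 2) * u j * (frameHessRaw (L := L) τ M k j - frameHessRaw (L := L) τ M j k)| ≤ K₁ * ∑ j, |u j| := by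
      calc |∑ j, (1 / 2) * u j * (frameHessRaw (L := L) τ M k j - frameHessRaw (L := L) τ M j k)|
          ≤ ∑ j, |(1 / 2) * u j * (frameHessRaw (L := L) τ M k j - frameHessRaw (L := L) τ M j k)| := Finset.abs_sum_le_sum_abs _ _
        _ ≤ ∑ j, K₁ * |u j| := Finset.sum_le_sum fun j _ => by
            rw [abs_mul, abs_mul, abs_of_pos (by norm_num : (0 : ℝ) < 1 / 2)]
            have := hanti j
            have hu0 : 0 ≤ |u j| := abs_nonneg _
            nlinarith
        _ = K₁ * ∑ j, |u j| := by rw [Finset.mul_sum]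
    have hmain : |frameGrad (L := L) τ M k + ∑ j, u j * frameHessRaw (L := L) τ M j k| ≤ K₂ := by
      rw [frameGrad]; exact hT
    exact (abs_add_le _ _).trans (by linarith)
  · -- (c3) symmetry at the zero
    ext j k
    rw [Matrix.transpose_apply, frameHessRaw, frameHessRaw]
    exact (frameD_frameD_symm_of_zero (L := L) (hτ j) (hτ k) hp).symm
  · -- (c3) positivity at the zero
    intro v
    have h := hessian_nonneg_at_zero (dirOf τ v) (dirOf_conjTranspose hτ v) (dirOf_trace hτ0 v) hp
    rwa [frameD_dirOf_frameD_dirOf] at h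
  · -- (c4) drift of the symmetrised Hessian
    intro j k
    have h1' := hessian_drift Yu (τ j) (τ k) hYuH hYu0 P (hK1 j k)
    have h2' := hessian_drift Yu (τ k) (τ j) hYuH hYu0 P (hK1 k j)
    simp only [hH, hM, frameHess, frameHessRaw] at h1' h2' ⊢
    rw [abs_le] at h1' h2' ⊢
    constructor <;> linarith [h1'.1, h1'.2, h2'.1, h2'.2]

/-! ## §3 Consequences for the matrix layer: the floor and the approximate kernel -/

omit [NeZero L] in
/-- Entrywise drift controls the quadratic form: `|vᵀAv − vᵀBv| ≤ K·#ι·|v|²` when `|A_jk − B_jk| ≤ K` (`K ≥ 0`). [folklore] -/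
theorem abs_form_sub_le [Fintype ι] {A B : Matrix ι ι ℝ} {K : ℝ} (hK : 0 ≤ K) (hAB : ∀ j k, |A j k - B j k| ≤ K) (v : ι → ℝ) :
    |v ⬝ᵥ (A *ᵥ v) - v ⬝ᵥ (B *ᵥ v)| ≤ K * (Fintype.card ι * (v ⬝ᵥ v)) := by
  have hdiff : v ⬝ᵥ (A *ᵥ v) - v ⬝ᵥ (B *ᵥ v) = ∑ j, ∑ k, v j * (A j k - B j k) * v k := by
    simp only [dotProduct, mulVec, Finset.mul_sum, ← Finset.sum_sub_distrib]
    refine Finset.sum_congr rfl fun j _ => Finset.sum_congr rfl fun k _ => by ring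
  rw [hdiff]
  have hcs : (∑ j, |v j|) ^ 2 ≤ Fintype.card ι * (v ⬝ᵥ v) := by
    have h := sq_sum_le_card_mul_sum_sq (s := Finset.univ) (f := fun j => |v j|)
    simp only [Finset.card_univ, sq_abs] at h
    have e : v ⬝ᵥ v = ∑ j, v j ^ 2 := by simp [dotProduct, sq]
    rw [e]; exact h
  calc |∑ j, ∑ k, v j * (A j k - B j k) * v k| ≤ ∑ j, |∑ k, v j * (A j k - B j k) * v k| := Finset.abs_sum_le_sum_abs _ _
    _ ≤ ∑ j, ∑ k, |v j * (A j k - B j k) * v k| := Finset.sum_le_sum fun j _ => Finset.abs_sum_le_sum_abs _ _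
    _ ≤ ∑ j, ∑ k, K * (|v j| * |v k|) := Finset.sum_le_sum fun j _ => Finset.sum_le_sum fun k _ => by
        rw [abs_mul, abs_mul]
        have := hAB j k
        have h1 : 0 ≤ |v j| := abs_nonneg _
        have h2 : 0 ≤ |v k| := abs_nonneg _
        nlinarith [mul_nonneg h1 h2]
    _ = K * (∑ j, |v j|) ^ 2 := by
        rw [sq, Finset.sum_mul_sum, Finset.mul_sum]
        refine Finset.sum_congr rfl fun j _ => ?_
        rw [Finset.mul_sum]
    _ ≤ K * (Fintype.card ι * (v ⬝ᵥ v)) := mul_le_mul_of_nonneg_left hcs hK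

omit [NeZero L] in
/-- ★ **The floor from the drift**: if `B` is positive-semidefinite (`vᵀBv ≥ 0`, e.g. the frame Hessian at the zero) and `|A_jk − B_jk| ≤ K`,
then `vᵀ(A + λ⋆·1)v ≥ (λ⋆ − K·#ι)|v|²` — the positive floor `c = λ⋆/2` of the matrix layer once `K·#ι ≤ λ⋆/2`. [folklore] -/
theorem floor_of_drift [Fintype ι] [DecidableEq ι] {A B : Matrix ι ι ℝ} {K lam : ℝ} (hK : 0 ≤ K) (hAB : ∀ j k, |A j k - B j k| ≤ K)
    (hB : ∀ v, 0 ≤ v ⬝ᵥ (B *ᵥ v)) (v : ι → ℝ) :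
    (lam - K * Fintype.card ι) * (v ⬝ᵥ v) ≤ v ⬝ᵥ ((A + lam • (1 : Matrix ι ι ℝ)) *ᵥ v) := by
  classical
  have h := abs_form_sub_le hK hAB v
  have hsplit : v ⬝ᵥ ((A + lam • (1 : Matrix ι ι ℝ)) *ᵥ v) = v ⬝ᵥ (A *ᵥ v) + lam * (v ⬝ᵥ v) := by
    rw [add_mulVec, smul_mulVec, one_mulVec, dotProduct_add, dotProduct_smul, smul_eq_mul]
  rw [hsplit]
  have hlow : v ⬝ᵥ (B *ᵥ v) - K * (Fintype.card ι * (v ⬝ᵥ v)) ≤ v ⬝ᵥ (A *ᵥ v) := by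
    have := (abs_le.1 h).1; linarith
  nlinarith [hB v]

omit [NeZero L] in
/-- ★ **Approximate kernel from the kernel at the zero**: a unit vector `k` with `Bk = 0` has `kᵀAk ≤ K·#ι` when `|A_jk − B_jk| ≤ K` — the
`s` of ✓`ResolventField.trace_resolvent_le` for the kernel vectors of the frame Hessian at the nearby flat history. [folklore] -/
theorem approxKernel_of_kernel [Fintype ι] {A B : Matrix ι ι ℝ} {K : ℝ} (hK : 0 ≤ K) (hAB : ∀ j k, |A j k - B j k| ≤ K)
    {k : ι → ℝ} (hk : k ⬝ᵥ k = 1) (hBk : B *ᵥ k = 0) : k ⬝ᵥ (A *ᵥ k) ≤ K * Fintype.card ι := by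
  have h := abs_form_sub_le hK hAB k
  rw [hBk, dotProduct_zero, sub_zero, hk, mul_one] at h
  exact (abs_le.1 h).2

end Summit.QuantumFields.YangMills.Theorems.VirialFluxGap.FrameHessian

end
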